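import Summits.Ventures.PercRepro.RankLevelSetRuleQCellThreeRow

/-!
# PercRepro — THE CELL `(q+4, q)`, PART 1: `Φ(q+4, q)`, the three slice sums below `R̂`, and the tangent bound on `S₃`
(p4, gen 21; paper proofs/P4-CELL-THREE.md §7)

For `k = 4` and `u = q − m ≥ 2` the lower bound `R̂(q, 4, m) ≥ (u+4)·S₁ + C(u+4, 2)·S₂ + C(u+4, 3)·S₃`,
`S_j := Σ_{a ≤ m} C(m, a)/C(q+j+a, a+j)`, holds with EQUALITY for `u ≥ 3` and as an inequality on the truncated slice
`u = 2` (`mhat_le_choose`: `m̂(q, m; a, j) ≤ C(q+j+a, a+j)` always). `Φ(q+4, q) = (q+4)(3q+7)/((q+1)(q+2))` (`phiK_four`).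
The new ingredient is the TANGENT BOUND `sliceThree_ge`: termwise `1/C(q+3+a, a+3) = w₃(a)/C(q+1+a, a+1)` with
`w₃(a) = (a+2)(a+3)/((q+a+2)(q+a+3))`, and
`(a+2)(a+3)(q+3)² = −4(q+a+2)(q+a+3) + (5q+13)(a+2)(q+a+3) + q(q+1)a²`, so
`S₃ ≥ ((5q+13)·S₂ − 4·S₁)/(q+3)²` (equality at `m = 0`) — the supporting line of the convex `1/x` at `x₀ = q(q+3)/(q+2)`.
Finally `row_D_le_two`: on the slice `u = 2` the two top terms of `Σ_{i<m} C(N, i)` sharpen the geometric bound of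
RankLevelSetRuleQCellThreeRow to `2D·(m+4)(m+5) ≤ m(m² + 3m + 8)·C(N, m)`.
RankLevelSetRuleQCellFour assembles `rhatCell_four` from these. Axioms: standard.
-/

namespace PercRepro

open Finset

/-! ### §1 `Φ(q+4, q)` -/

/-- `C(n+3, 3) = (n+3)(n+2)(n+1)/6` in `ℚ`. -/
lemma cast_choose_three (n : ℕ) : ((n + 3).choose 3 : ℚ) = (n + 3) * (n + 2) * (n + 1) / 6 := by
  have h := Nat.choose_succ_right_eq (n + 3) 2
  rw [show n + 3 - 2 = n + 1 by omega] at h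
  have h' : (((n + 3).choose 3 * 3 : ℕ) : ℚ) = (((n + 3).choose 2 * (n + 1) : ℕ) : ℚ) := by
    rw [show (2 : ℕ) + 1 = 3 from rfl] at h; rw [h]
  push_cast [Nat.cast_choose_two] at h'
  have h2 : ((n : ℚ) + 3 - 1) = n + 2 := by ring
  rw [h2] at h'
  linarith [h']

/-- `Φ(q+4, q) = (q+4)(3q+7)/((q+1)(q+2))`. -/
lemma phiK_four (q : ℕ) : phiK (q + 4) q = ((q : ℚ) + 4) * (3 * q + 7) / ((q + 1) * (q + 2)) := by
  rw [phiK_eq_sum_range q 4 (by omega), show (4 : ℕ) - 1 = 1 + 1 + 1 from rfl,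
    Finset.sum_range_succ _ (1 + 1), Finset.sum_range_succ _ 1, Finset.sum_range_one]
  simp only [zero_add, add_zero, Nat.choose_one_right, Nat.reduceAdd]
  have h1 : (q + 1).choose q = q + 1 := by rw [Nat.choose_symm_add, Nat.choose_one_right]
  have h2 : (q + 1 + 1).choose q = (q + 1 + 1).choose 2 := by
    rw [show q + 1 + 1 = q + 2 by ring, Nat.choose_symm_add]
  have h3 : (q + 2 + 1).choose q = (q + 3).choose 3 := by
    rw [show q + 2 + 1 = q + 3 by ring, Nat.choose_symm_add]
  rw [h1, h2, h3, show q + 1 + 1 = q + 2 by ring, Nat.cast_choose_two, Nat.cast_choose_two, cast_choose_three,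
    cast_choose_three]
  push_cast
  rw [show ((q : ℚ) + 4 - 1) = q + 3 by ring, show ((q : ℚ) + 2 - 1) = q + 1 by ring]
  have hq : (0 : ℚ) < q + 1 := by positivity
  rw [div_add_div _ _ hq.ne' (by positivity), div_add_div _ _ (by positivity) (by positivity),
    div_eq_div_iff (by positivity) (by positivity)]
  ring

/-! ### §2 `m̂ ≤ C(q+j+a, a+j)` -/

/-- Vandermonde in the shape of `m̂`: `Σ_{t ≤ j} C(j, t)·C(n, a+t) = C(n+j, a+j)`. -/
lemma sum_choose_mul_choose_add (n a j : ℕ) :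
    ∑ t ∈ range (j + 1), j.choose t * n.choose (a + t) = (n + j).choose (a + j) := by
  induction j generalizing a with
  | zero => simp
  | succ j ih =>
    rw [Finset.sum_range_succ']
    simp only [Nat.choose_zero_right, one_mul, add_zero]
    have hsplit : ∑ t ∈ range (j + 1), (j + 1).choose (t + 1) * n.choose (a + (t + 1))
        = ∑ t ∈ range (j + 1), j.choose t * n.choose (a + 1 + t)
          + ∑ t ∈ range (j + 1), j.choose (t + 1) * n.choose (a + (t + 1)) := by
      rw [← Finset.sum_add_distrib]
      refine Finset.sum_congr rfl (fun t _ => ?_)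
      rw [Nat.choose_succ_succ, add_mul, show a + 1 + t = a + (t + 1) by ring]
    have hshift : ∑ t ∈ range (j + 1), j.choose (t + 1) * n.choose (a + (t + 1)) + n.choose a
        = (n + j).choose (a + j) := by
      rw [← ih a, Finset.sum_range_succ' (fun t => j.choose t * n.choose (a + t)) j]
      simp only [Nat.choose_zero_right, one_mul, add_zero]
      rw [Finset.sum_range_succ (fun t => j.choose (t + 1) * n.choose (a + (t + 1))) j, Nat.choose_succ_self,
        zero_mul, add_zero]
    have e1 := ih (a + 1)
    rw [show a + 1 + j = a + j + 1 by ring] at e1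
    have e3 : (n + (j + 1)).choose (a + (j + 1)) = (n + j).choose (a + j) + (n + j).choose (a + j + 1) := by
      rw [show n + (j + 1) = n + j + 1 by ring, show a + (j + 1) = a + j + 1 by ring, Nat.choose_succ_succ']
    rw [hsplit, e3]
    omega

/-- **`m̂(q, m; a, j) ≤ C(q+j+a, a+j)`** (the truncation only drops terms). -/
lemma mhat_le_choose (q m a j : ℕ) : mhat q m a j ≤ (q + j + a).choose (a + j) := by
  rw [mhat_eq]
  calc ∑ tD ∈ range (min j (q - m) + 1), j.choose tD * (q + a).choose (a + tD)
      ≤ ∑ tD ∈ range (j + 1), j.choose tD * (q + a).choose (a + tD) := by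
        apply Finset.sum_le_sum_of_subset
        intro t ht
        rw [Finset.mem_range] at ht ⊢
        omega
    _ = (q + j + a).choose (a + j) := by
        rw [sum_choose_mul_choose_add (q + a) a j, show q + a + j = q + j + a by ring]

/-! ### §3 `R̂(q, 4, m)` is at least the three slice sums (`u = q − m ≥ 2`, `q = m + v + 2`) -/

/-- `C(v+6, 2) = (v+6)(v+5)/2` and `C(v+6, 3) = (v+6)(v+5)(v+4)/6` are the weights of the cell `(q+4, q)`. -/
lemma rhat_four_ge (m v : ℕ) :
    ((v : ℚ) + 6) * ∑ a ∈ range (m + 1), (m.choose a : ℚ) / ((m + v + 2 + 1 + a).choose (a + 1) : ℚ)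
      + ((v : ℚ) + 6) * ((v : ℚ) + 5) / 2
          * ∑ a ∈ range (m + 1), (m.choose a : ℚ) / ((m + v + 2 + 2 + a).choose (a + 2) : ℚ)
      + ((v : ℚ) + 6) * ((v : ℚ) + 5) * ((v : ℚ) + 4) / 6
          * ∑ a ∈ range (m + 1), (m.choose a : ℚ) / ((m + v + 2 + 3 + a).choose (a + 3) : ℚ)
      ≤ rhat (m + v + 2) 4 m := by
  unfold rhat
  rw [sum_Ioo_nat, show (4 : ℕ) - (0 + 1) = 1 + 1 + 1 from rfl, Finset.sum_range_succ _ (1 + 1),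
    Finset.sum_range_succ _ 1, Finset.sum_range_one]
  simp only [zero_add, add_zero, Nat.reduceAdd, show m + v + 2 + 4 - m = v + 6 by omega, Nat.choose_one_right]
  have h2 : ((v + 6).choose 2 : ℚ) = (v + 6) * (v + 5) / 2 := by
    rw [Nat.cast_choose_two]; push_cast; ring
  have h3 : ((v + 6).choose 3 : ℚ) = (v + 6) * (v + 5) * (v + 4) / 6 := by
    rw [show v + 6 = v + 3 + 3 by ring, cast_choose_three]; push_cast; ring
  -- termwise: `C(m,a)·w / C(q+j+a, a+j) ≤ C(m,a)·w / m̂`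
  have key : ∀ (j a : ℕ) (w : ℚ), 0 ≤ w →
      (m.choose a : ℚ) * w / ((m + v + 2 + j + a).choose (a + j) : ℚ)
        ≤ (m.choose a : ℚ) * w / (mhat (m + v + 2) m a j : ℚ) := by
    intro j a w hw
    apply div_le_div_of_nonneg_left (by positivity) (by exact_mod_cast mhat_pos _ _ _ _)
    exact_mod_cast mhat_le_choose (m + v + 2) m a j
  have s1 : ((v : ℚ) + 6) * ∑ a ∈ range (m + 1), (m.choose a : ℚ) / ((m + v + 2 + 1 + a).choose (a + 1) : ℚ)
      ≤ ∑ a ∈ range (m + 1), ((m.choose a * (v + 6) : ℕ) : ℚ) / (mhat (m + v + 2) m a 1 : ℚ) := by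
    rw [Finset.mul_sum]
    refine Finset.sum_le_sum (fun a _ => ?_)
    push_cast
    rw [show ((v : ℚ) + 6) * ((m.choose a : ℚ) / ((m + v + 2 + 1 + a).choose (a + 1) : ℚ))
      = (m.choose a : ℚ) * ((v : ℚ) + 6) / ((m + v + 2 + 1 + a).choose (a + 1) : ℚ) by ring]
    exact key 1 a _ (by positivity)
  have s2 : ((v : ℚ) + 6) * ((v : ℚ) + 5) / 2
        * ∑ a ∈ range (m + 1), (m.choose a : ℚ) / ((m + v + 2 + 2 + a).choose (a + 2) : ℚ)
      ≤ ∑ a ∈ range (m + 1), ((m.choose a * (v + 6).choose 2 : ℕ) : ℚ) / (mhat (m + v + 2) m a 2 : ℚ) := by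
    rw [Finset.mul_sum]
    refine Finset.sum_le_sum (fun a _ => ?_)
    push_cast
    rw [h2, show ((v : ℚ) + 6) * ((v : ℚ) + 5) / 2 * ((m.choose a : ℚ) / ((m + v + 2 + 2 + a).choose (a + 2) : ℚ))
      = (m.choose a : ℚ) * (((v : ℚ) + 6) * ((v : ℚ) + 5) / 2) / ((m + v + 2 + 2 + a).choose (a + 2) : ℚ) by ring]
    exact key 2 a _ (by positivity)
  have s3 : ((v : ℚ) + 6) * ((v : ℚ) + 5) * ((v : ℚ) + 4) / 6
        * ∑ a ∈ range (m + 1), (m.choose a : ℚ) / ((m + v + 2 + 3 + a).choose (a + 3) : ℚ)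
      ≤ ∑ a ∈ range (m + 1), ((m.choose a * (v + 6).choose 3 : ℕ) : ℚ) / (mhat (m + v + 2) m a 3 : ℚ) := by
    rw [Finset.mul_sum]
    refine Finset.sum_le_sum (fun a _ => ?_)
    push_cast
    rw [h3, show ((v : ℚ) + 6) * ((v : ℚ) + 5) * ((v : ℚ) + 4) / 6
        * ((m.choose a : ℚ) / ((m + v + 2 + 3 + a).choose (a + 3) : ℚ))
      = (m.choose a : ℚ) * (((v : ℚ) + 6) * ((v : ℚ) + 5) * ((v : ℚ) + 4) / 6)
          / ((m + v + 2 + 3 + a).choose (a + 3) : ℚ) by ring]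
    exact key 3 a _ (by positivity)
  linarith [s1, s2, s3]

/-! ### §4 The tangent bound on `S₃` -/

/-- Termwise: `(−4/C(q+1+a, a+1) + (5q+13)/C(q+2+a, a+2))/(q+3)² ≤ 1/C(q+3+a, a+3)`
(the supporting line of `1/x` at `x₀ = q(q+3)/(q+2)`; the remainder is `q(q+1)a²/((q+a+2)(q+a+3)(q+3)²·C(q+1+a, a+1))`). -/
lemma sliceThree_term (q a : ℕ) :
    ((-4 : ℚ) / ((q + 1 + a).choose (a + 1) : ℚ) + (5 * q + 13) / ((q + 2 + a).choose (a + 2) : ℚ))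
        / ((q : ℚ) + 3) ^ 2
      ≤ 1 / ((q + 3 + a).choose (a + 3) : ℚ) := by
  have hX : (0 : ℚ) < (q + 1 + a).choose (a + 1) := by exact_mod_cast Nat.choose_pos (by omega)
  have hY : (0 : ℚ) < (q + 2 + a).choose (a + 2) := by exact_mod_cast Nat.choose_pos (by omega)
  have hZ : (0 : ℚ) < (q + 3 + a).choose (a + 3) := by exact_mod_cast Nat.choose_pos (by omega)
  -- `(q+a+2)·C(q+1+a, a+1) = C(q+2+a, a+2)·(a+2)` and `(q+a+3)·C(q+2+a, a+2) = C(q+3+a, a+3)·(a+3)`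
  have hXY : ((q : ℚ) + 2 + a) * ((q + 1 + a).choose (a + 1) : ℚ) = ((q + 2 + a).choose (a + 2) : ℚ) * (a + 2) := by
    have h := Nat.add_one_mul_choose_eq (q + 1 + a) (a + 1)
    rw [show q + 1 + a + 1 = q + 2 + a by ring, show a + 1 + 1 = a + 2 by ring] at h
    exact_mod_cast h
  have hYZ : ((q : ℚ) + 3 + a) * ((q + 2 + a).choose (a + 2) : ℚ) = ((q + 3 + a).choose (a + 3) : ℚ) * (a + 3) := by
    have h := Nat.add_one_mul_choose_eq (q + 2 + a) (a + 2)
    rw [show q + 2 + a + 1 = q + 3 + a by ring, show a + 2 + 1 = a + 3 by ring] at h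
    exact_mod_cast h
  rw [div_add_div _ _ hX.ne' hY.ne', div_div, div_le_div_iff₀ (by positivity) hZ]
  set X := ((q + 1 + a).choose (a + 1) : ℚ)
  set Y := ((q + 2 + a).choose (a + 2) : ℚ)
  set Z := ((q + 3 + a).choose (a + 3) : ℚ)
  -- `(a+2)(a+3)·(X·Y·(q+3)² − (−4Y + (5q+13)X)·Z) = X·Y·q(q+1)·a²`
  have hid : ((a : ℚ) + 2) * ((a : ℚ) + 3) * (1 * (X * Y * ((q : ℚ) + 3) ^ 2) - (-4 * Y + (5 * q + 13) * X) * Z)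
      = X * Y * q * (q + 1) * (a : ℚ) ^ 2 := by
    linear_combination (((a : ℚ) + 2) * (-4 * Y + (5 * (q : ℚ) + 13) * X)) * hYZ
      - (4 * ((q : ℚ) + 3 + a) * Y) * hXY
  have hpos : (0 : ℚ) ≤ ((a : ℚ) + 2) * ((a : ℚ) + 3) * (1 * (X * Y * ((q : ℚ) + 3) ^ 2) - (-4 * Y + (5 * q + 13) * X) * Z) := by
    rw [hid]; positivity
  have := nonneg_of_mul_nonneg_right hpos (by positivity)
  linarith

/-- **The tangent bound on `S₃`**: `((5q+13)·S₂ − 4·S₁)/(q+3)² ≤ S₃` (equality at `m = 0`). -/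
lemma sliceThree_ge (q m : ℕ) :
    ((5 * (q : ℚ) + 13) * ∑ a ∈ range (m + 1), (m.choose a : ℚ) / ((q + 2 + a).choose (a + 2) : ℚ)
        - 4 * ∑ a ∈ range (m + 1), (m.choose a : ℚ) / ((q + 1 + a).choose (a + 1) : ℚ)) / ((q : ℚ) + 3) ^ 2
      ≤ ∑ a ∈ range (m + 1), (m.choose a : ℚ) / ((q + 3 + a).choose (a + 3) : ℚ) := by
  rw [Finset.mul_sum, Finset.mul_sum, ← Finset.sum_sub_distrib, Finset.sum_div]
  refine Finset.sum_le_sum (fun a _ => ?_)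
  have h := sliceThree_term q a
  have hw : (0 : ℚ) ≤ m.choose a := by positivity
  calc ((5 * (q : ℚ) + 13) * ((m.choose a : ℚ) / ((q + 2 + a).choose (a + 2) : ℚ))
          - 4 * ((m.choose a : ℚ) / ((q + 1 + a).choose (a + 1) : ℚ))) / ((q : ℚ) + 3) ^ 2
        = (m.choose a : ℚ) * (((-4 : ℚ) / ((q + 1 + a).choose (a + 1) : ℚ)
            + (5 * q + 13) / ((q + 2 + a).choose (a + 2) : ℚ)) / ((q : ℚ) + 3) ^ 2) := by ring
    _ ≤ (m.choose a : ℚ) * (1 / ((q + 3 + a).choose (a + 3) : ℚ)) := mul_le_mul_of_nonneg_left h hw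
    _ = (m.choose a : ℚ) / ((q + 3 + a).choose (a + 3) : ℚ) := by ring

/-! ### §5 The two-term bound on `D` on the slice `u = 2` (`q = m + 2`, `m ≥ 2`, `m = m' + 2`) -/

/-- On the row `N = 2m + 3` (`u = 2`) with `m = m' + 2`: `2D·(m+4)(m+5) ≤ m(m² + 3m + 8)·C(N, m)`
(from `Σ_{i ≤ m} C(N, i) ≥ C(N, m) + C(N, m−1) + C(N, m−2)` and `row_id_one`). -/
lemma row_D_le_two (m' : ℕ) :
    2 * (∑ i ∈ range (m' + 2 + 1), (((m' + 2 : ℕ) : ℚ) - i) * ((2 * (m' + 2) + 2 + 1).choose i : ℚ))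
        * (((m' : ℚ) + 2) + 4) * (((m' : ℚ) + 2) + 5)
      ≤ ((m' : ℚ) + 2) * (((m' : ℚ) + 2) ^ 2 + 3 * ((m' : ℚ) + 2) + 8) * ((2 * (m' + 2) + 2 + 1).choose (m' + 2) : ℚ) := by
  have hid := row_id_one (m' + 2) 2
  push_cast at hid ⊢
  set N := 2 * (m' + 2) + 2 + 1 with hN
  set C := (N.choose (m' + 2) : ℚ) with hC
  set D := ∑ i ∈ range (m' + 2 + 1), (((m' : ℚ) + 2) - i) * (N.choose i : ℚ) with hD
  -- the three top terms of `Q`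
  have hQ : (N.choose m' : ℚ) + (N.choose (m' + 1) : ℚ) + C
      ≤ ∑ i ∈ range (m' + 2 + 1), (N.choose i : ℚ) := by
    rw [Finset.sum_range_succ, Finset.sum_range_succ, Finset.sum_range_succ]
    have : (0 : ℚ) ≤ ∑ i ∈ range m', (N.choose i : ℚ) := by positivity
    rw [hC]; linarith
  -- `C(N, m+1)·(m'+6) = (m'+2)·C(N, m'+2)` and `C(N, m')·(m'+7) = (m'+1)·C(N, m'+1)` (`choose_succ_right_eq`)
  have h1 : (N.choose (m' + 1) : ℚ) * ((m' : ℚ) + 6) = ((m' : ℚ) + 2) * C := by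
    have h := Nat.choose_succ_right_eq N (m' + 1)
    rw [show N - (m' + 1) = m' + 6 by omega, show m' + 1 + 1 = m' + 2 by ring] at h
    have h' : ((N.choose (m' + 2) * (m' + 2) : ℕ) : ℚ) = ((N.choose (m' + 1) * (m' + 6) : ℕ) : ℚ) := by rw [h]
    push_cast at h'
    rw [hC]; linarith [h']
  have h2 : (N.choose m' : ℚ) * ((m' : ℚ) + 7) = ((m' : ℚ) + 1) * (N.choose (m' + 1) : ℚ) := by
    have h := Nat.choose_succ_right_eq N m'
    rw [show N - m' = m' + 7 by omega] at h
    have h' : ((N.choose (m' + 1) * (m' + 1) : ℕ) : ℚ) = ((N.choose m' * (m' + 7) : ℕ) : ℚ) := by rw [h]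
    push_cast at h'
    linarith [h']
  have e1 : 3 * (N.choose (m' + 1) : ℚ) * (((m' : ℚ) + 2) + 4) * (((m' : ℚ) + 2) + 5)
      = 3 * ((m' : ℚ) + 2) * ((m' : ℚ) + 7) * C := by
    linear_combination (3 * ((m' : ℚ) + 7)) * h1
  have e2 : 3 * (N.choose m' : ℚ) * (((m' : ℚ) + 2) + 4) * (((m' : ℚ) + 2) + 5)
      = 3 * ((m' : ℚ) + 1) * ((m' : ℚ) + 2) * C := by
    linear_combination (3 * ((m' : ℚ) + 6)) * h2 + (3 * ((m' : ℚ) + 1)) * h1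
  have hQ' := mul_le_mul_of_nonneg_left hQ
    (by positivity : (0 : ℚ) ≤ 3 * ((((m' : ℚ) + 2) + 4) * (((m' : ℚ) + 2) + 5)))
  nlinarith [hid, hQ', e1, e2]

end PercRepro
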